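import Summits.CriticalPhenomena.CardyFormulaZ2.Theorems.CardyBondTriangularBondTriangularBoxCrossingMoves
import Literature.Probability.Percolation.PlanarDuality
import Literature.Probability.Percolation.IsoradialBoxBootstrap
import Literature.Probability.Percolation.IsoradialCriticalityProofs
import Literature.Probability.LatticeModels.IsoradialDual
import Literature.Probability.Percolation.BondTriangularThetaComparison
import Literature.Probability.Percolation.SelfRefinementMeasure
import Literature.Probability.Percolation.RSW
import HarnessLib

/-!
# Route CardyBondTriangular — item `BondTriangularBoxCrossing`: clipping open walks

Elementary surgery on open walks used to read crossings of Euclidean boxes and of lattice boxes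
off longer open paths (GM13 §3.3: "truncation of transported open paths to crossings of boxes";
Grimmett 1999, §11.7): for a function `f` of the vertices changing by at most `ℓ` along the edges,
a walk from `{f ≤ a}` to `{b ≤ f}` contains a sub-walk from its last vertex in `{f ≤ a}` to its
first subsequent vertex in `{b ≤ f}`, all of whose vertices satisfy `a − ℓ < f < b + ℓ`
(`Walk.exists_clip_real`; integer form with exact levels `Walk.exists_clip_int`).
-/

namespace Summit.CriticalPhenomena.CardyFormulaZ2.Theorems.TriSweep

open Literature.Probability.Percolation Literature.Probability.LatticeModels

variable {V : Type*} {H : SimpleGraph V}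

/-- **First passage above a level.** A walk from `x` with `f x ≤ b` to `y` with `b ≤ f y` has a
prefix ending at a vertex `z` with `b ≤ f z < b + ℓ`, all of whose other vertices have `f < b`. -/
theorem Walk.exists_first_ge (f : V → ℝ) {ℓ : ℝ} (hℓ : 0 < ℓ)
    (hf : ∀ u v, H.Adj u v → f v ≤ f u + ℓ) :
    ∀ {x y : V} (p : H.Walk x y) (b : ℝ), f x ≤ b → b ≤ f y →
      ∃ (z : V) (q : H.Walk x z), b ≤ f z ∧ f z < b + ℓ ∧
        ∀ v ∈ q.support, v ∈ p.support ∧ f v < b + ℓ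
  | x, _, .nil, b, hx, hy =>
    ⟨x, .nil, hy, by linarith, fun v hv => by
      rw [SimpleGraph.Walk.support_nil, List.mem_singleton] at hv
      subst hv; exact ⟨by simp, by linarith⟩⟩
  | x, y, .cons (v := w) hadj p, b, hx, hy => by
    rcases le_or_gt b (f x) with hbx | hbx
    · exact ⟨x, .nil, hbx, by linarith, fun v hv => by
        rw [SimpleGraph.Walk.support_nil, List.mem_singleton] at hv
        subst hv; exact ⟨by simp, by linarith⟩⟩
    have hw : f w ≤ f x + ℓ := hf x w hadj
    rcases le_or_gt b (f w) with hbw | hbw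
    · refine ⟨w, .cons hadj .nil, hbw, by linarith, fun v hv => ?_⟩
      rw [SimpleGraph.Walk.support_cons, SimpleGraph.Walk.support_nil, List.mem_cons,
        List.mem_singleton] at hv
      rcases hv with rfl | rfl
      · exact ⟨by simp, by linarith⟩
      · exact ⟨by simp, by linarith⟩
    · obtain ⟨z, q, hz1, hz2, hq⟩ := Walk.exists_first_ge f hℓ hf p b hbw.le hy
      refine ⟨z, .cons hadj q, hz1, hz2, fun v hv => ?_⟩
      rw [SimpleGraph.Walk.support_cons, List.mem_cons] at hv
      rcases hv with rfl | hv
      · exact ⟨by simp, by linarith⟩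
      · exact ⟨by rw [SimpleGraph.Walk.support_cons]; exact List.mem_cons_of_mem _ (hq v hv).1,
          (hq v hv).2⟩

/-- **Clipping an open walk to a window** `[a, b]` of a function `f` of the vertices with
`|f u − f v| ≤ ℓ` along the edges: a walk from `{f ≤ a}` to `{b ≤ f}` (`a ≤ b`) contains a walk
from a vertex `x'` with `a − ℓ < f x' ≤ a` to a vertex `y'` with `b ≤ f y' < b + ℓ`, all of whose
vertices are vertices of the walk with `a − ℓ < f < b + ℓ`. -/
theorem Walk.exists_clip_real (f : V → ℝ) {ℓ : ℝ} (hℓ : 0 < ℓ)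
    (hf : ∀ u v, H.Adj u v → f v ≤ f u + ℓ) {x y : V} (p : H.Walk x y) {a b : ℝ} (hab : a ≤ b)
    (hx : f x ≤ a) (hy : b ≤ f y) :
    ∃ (x' y' : V) (q : H.Walk x' y'), (a - ℓ < f x' ∧ f x' ≤ a) ∧ (b ≤ f y' ∧ f y' < b + ℓ) ∧
      ∀ v ∈ q.support, v ∈ p.support ∧ a - ℓ < f v ∧ f v < b + ℓ := by
  have hf' : ∀ u v, H.Adj u v → (-f) v ≤ (-f) u + ℓ := fun u v h => by
    have := hf v u h.symm; simp only [Pi.neg_apply]; linarith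
  -- last visit to `{f ≤ a}`: first passage of the reversed walk above the level `-a` of `-f`
  obtain ⟨x', q₁, h1, h2, hq₁⟩ := Walk.exists_first_ge (-f) hℓ hf' p.reverse (-a)
    (by simp only [Pi.neg_apply]; linarith) (by simp only [Pi.neg_apply]; linarith)
  simp only [Pi.neg_apply] at h1 h2 hq₁
  -- `q₁.reverse : x' → y` has all vertices in `{a - ℓ < f}`; first passage above `b`
  obtain ⟨y', q, h3, h4, hq⟩ := Walk.exists_first_ge f hℓ hf q₁.reverse b (by linarith) hy
  refine ⟨x', y', q, ⟨by linarith, by linarith⟩, ⟨h3, h4⟩, fun v hv => ?_⟩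
  obtain ⟨hv1, hv2⟩ := hq v hv
  rw [SimpleGraph.Walk.support_reverse, List.mem_reverse] at hv1
  obtain ⟨hv3, hv4⟩ := hq₁ v hv1
  rw [SimpleGraph.Walk.support_reverse, List.mem_reverse] at hv3
  exact ⟨hv3, by linarith, hv2⟩

/-- **Integer form with exact levels**: for an integer-valued `f` changing by at most `1` along
the edges, the clipped walk starts exactly at the level `a` and ends exactly at the level `b`. -/
theorem Walk.exists_clip_int (f : V → ℤ) (hf : ∀ u v, H.Adj u v → f v ≤ f u + 1) {x y : V}
    (p : H.Walk x y) {a b : ℤ} (hab : a ≤ b) (hx : f x ≤ a) (hy : b ≤ f y) :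
    ∃ (x' y' : V) (q : H.Walk x' y'), f x' = a ∧ f y' = b ∧
      ∀ v ∈ q.support, v ∈ p.support ∧ a ≤ f v ∧ f v ≤ b := by
  obtain ⟨x', y', q, ⟨h1, h2⟩, ⟨h3, h4⟩, hq⟩ := Walk.exists_clip_real (fun v => (f v : ℝ)) one_pos
    (fun u v h => by exact_mod_cast hf u v h) p (a := a) (b := b) (by exact_mod_cast hab)
    (by exact_mod_cast hx) (by exact_mod_cast hy)
  refine ⟨x', y', q, ?_, ?_, fun v hv => ?_⟩
  · have : (a : ℝ) - 1 < f x' := h1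
    have h1' : a - 1 < f x' := by exact_mod_cast this
    have h2' : f x' ≤ a := by exact_mod_cast h2
    omega
  · have h3' : b ≤ f y' := by exact_mod_cast h3
    have : (f y' : ℝ) < b + 1 := h4
    have h4' : f y' < b + 1 := by exact_mod_cast this
    omega
  · obtain ⟨hv1, hv2, hv3⟩ := hq v hv
    have hv2' : a - 1 < f v := by exact_mod_cast hv2
    have hv3' : f v < b + 1 := by exact_mod_cast hv3
    exact ⟨hv1, by omega, by omega⟩

/-- From an open connection inside `S` to an open walk inside `S` (lattice configurations). -/
theorem exists_openWalk_of_mem_openConnIn {G : SimpleGraph V} {ω : BondConfig V}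
    (hω : ω ⊆ G.edgeSet) {S : Set V} {x y : V} (h : ω ∈ openConnIn S x y) :
    ∃ p : (openGraph ω).Walk x y, ∀ z ∈ p.support, z ∈ S := by
  obtain ⟨p, hpS, hpω⟩ := exists_walk_of_mem_openConnIn hω h
  have hp : ∀ e ∈ p.edges, e ∈ (openGraph ω).edgeSet := fun e he => by
    rw [openGraph, SimpleGraph.edgeSet_fromEdgeSet]
    exact ⟨hpω e he, SimpleGraph.not_isDiag_of_mem_edgeSet _ (p.edges_subset_edgeSet he)⟩
  refine ⟨p.transfer (openGraph ω) hp, ?_⟩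
  rw [SimpleGraph.Walk.support_transfer]; exact hpS

/-! ### From lattice crossings to crossings of Euclidean boxes -/

/-- **A lattice crossing gives a left–right crossing of a Euclidean box.** If the real parts of
the positions of adjacent vertices differ by at most `2`, an open crossing inside a vertex set
drawn in the horizontal strip `0 ≤ im ≤ b`, from a set drawn in `{re ≤ 0}` to a set drawn in
`{a ≤ re}`, contains a left–right crossing of the box `[0, a] × [0, b]` in the sense of
`embRectCrossing` (GM13 §3.3, truncation of open paths to box crossings). -/
theorem embRectCrossing_of_openCrossing {W : Type*} {G : SimpleGraph W} {ω : BondConfig W}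
    (hω : ω ⊆ G.edgeSet) (zW : W → ℂ) (hG : ∀ u v, G.Adj u v → (zW v).re ≤ (zW u).re + 2)
    {U A B : Set W} {a b : ℝ} (ha : 0 ≤ a) (hU : ∀ v ∈ U, (zW v).im ∈ Set.Icc 0 b)
    (hA : ∀ v ∈ A, (zW v).re ≤ 0) (hB : ∀ v ∈ B, a ≤ (zW v).re) (h : ω ∈ openCrossing U A B) :
    ω ∈ embRectCrossing zW a b := by
  obtain ⟨x, hx, y, hy, hconn⟩ := h
  obtain ⟨p, hp⟩ := exists_openWalk_of_mem_openConnIn hω hconn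
  obtain ⟨x', y', q, ⟨-, hx'⟩, ⟨hy', -⟩, hq⟩ := Walk.exists_clip_real (fun v => (zW v).re) two_pos
    (fun u v huv => hG u v (IsoradialArmExtension.adj_of_openGraph_adj hω huv)) p ha (hA x hx) (hB y hy)
  refine ⟨x', hx', y', hy', mem_openConnIn_iff_exists_openWalk.2 ⟨q, fun v hv => ?_⟩⟩
  obtain ⟨hv1, hv2, hv3⟩ := hq v hv
  exact ⟨⟨by linarith, by linarith⟩, hU v (hp v hv1)⟩

/-- **A lattice crossing gives a top–bottom crossing of a Euclidean box** (`embTBCrossing`; the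
same with the roles of the real and imaginary parts exchanged). -/
theorem embTBCrossing_of_openCrossing {W : Type*} {G : SimpleGraph W} {ω : BondConfig W}
    (hω : ω ⊆ G.edgeSet) (zW : W → ℂ) (hG : ∀ u v, G.Adj u v → (zW v).im ≤ (zW u).im + 2)
    {U A B : Set W} {a b : ℝ} (hb : 0 ≤ b) (hU : ∀ v ∈ U, (zW v).re ∈ Set.Icc 0 a)
    (hA : ∀ v ∈ A, (zW v).im ≤ 0) (hB : ∀ v ∈ B, b ≤ (zW v).im) (h : ω ∈ openCrossing U A B) :
    ω ∈ embTBCrossing zW a b := by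
  obtain ⟨x, hx, y, hy, hconn⟩ := h
  obtain ⟨p, hp⟩ := exists_openWalk_of_mem_openConnIn hω hconn
  obtain ⟨x', y', q, ⟨-, hx'⟩, ⟨hy', -⟩, hq⟩ := Walk.exists_clip_real (fun v => (zW v).im) two_pos
    (fun u v huv => hG u v (IsoradialArmExtension.adj_of_openGraph_adj hω huv)) p hb (hA x hx) (hB y hy)
  refine ⟨x', hx', y', hy', mem_openConnIn_iff_exists_openWalk.2 ⟨q, fun v hv => ?_⟩⟩
  obtain ⟨hv1, hv2, hv3⟩ := hq v hv
  exact ⟨hU v (hp v hv1), ⟨by linarith, by linarith⟩⟩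

/-- The real parts of the positions of adjacent vertices of an isoradial graph differ by less
than `2` (the edges are shorter than `2`), for every translate of the drawing. -/
theorem re_le_re_add_two_of_adj {W F : Type*} {G : SimpleGraph W}
    {emb : RhombicEmbedding G F} (hiso : emb.IsIsoradial)
    (w : ℂ) (u v : W) (h : G.Adj u v) : (emb.z v - w).re ≤ (emb.z u - w).re + 2 := by
  have h1 := IsoradialCriticality.norm_z_sub_z_lt_two hiso ⟨(v, u), h.symm⟩
  have h2 := Complex.abs_re_le_norm (emb.z v - emb.z u)
  rw [Complex.sub_re] at h2
  simp only [Complex.sub_re]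
  linarith [(abs_le.1 (h2.trans h1.le)).2]

/-- The same for the imaginary parts. -/
theorem im_le_im_add_two_of_adj {W F : Type*} {G : SimpleGraph W}
    {emb : RhombicEmbedding G F} (hiso : emb.IsIsoradial)
    (w : ℂ) (u v : W) (h : G.Adj u v) : (emb.z v - w).im ≤ (emb.z u - w).im + 2 := by
  have h1 := IsoradialCriticality.norm_z_sub_z_lt_two hiso ⟨(v, u), h.symm⟩
  have h2 := Complex.abs_im_le_norm (emb.z v - emb.z u)
  rw [Complex.sub_im] at h2
  simp only [Complex.sub_im]
  linarith [(abs_le.1 (h2.trans h1.le)).2]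

/-- **Dual edges are at most `2` long**: the centres of the two faces of a dart of an isoradial
graph are both at distance `1` from its tail. -/
theorem norm_c_sub_c_le_two_of_dualGraph_adj {W F : Type*} {G : SimpleGraph W}
    {emb : RhombicEmbedding G F} (hiso : emb.IsIsoradial)
    {f g : F} (h : emb.dualGraph.Adj f g) : ‖emb.c f - emb.c g‖ ≤ 2 := by
  have key : ∀ d : G.Dart, ‖emb.c (emb.leftFace d) - emb.c (emb.rightFace d)‖ ≤ 2 := fun d => by
    have h1 := (hiso.norm_sub_eq_one d).1
    have h2 := (hiso.norm_sub_eq_one d.symm).2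
    rw [hiso.leftFace_symm d, SimpleGraph.Dart.symm_toProd, Prod.snd_swap] at h2
    calc ‖emb.c (emb.leftFace d) - emb.c (emb.rightFace d)‖
        = ‖(emb.c (emb.leftFace d) - emb.z d.fst) + (emb.z d.fst - emb.c (emb.rightFace d))‖ := by
          congr 1; ring
      _ ≤ ‖emb.c (emb.leftFace d) - emb.z d.fst‖ + ‖emb.z d.fst - emb.c (emb.rightFace d)‖ :=
          norm_add_le _ _
      _ = 2 := by rw [norm_sub_rev, h1, h2]; norm_num
  obtain ⟨-, ⟨d, rfl, rfl⟩ | ⟨d, rfl, rfl⟩⟩ := emb.dualGraph_adj.1 h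
  · exact key d
  · rw [norm_sub_rev]; exact key d

/-- The real parts of the centres of dual-adjacent faces differ by at most `2`. -/
theorem dual_re_le_re_add_two_of_adj {W F : Type*} {G : SimpleGraph W}
    {emb : RhombicEmbedding G F} (hiso : emb.IsIsoradial)
    (w : ℂ) (f g : F) (h : emb.dualGraph.Adj f g) : (emb.c g - w).re ≤ (emb.c f - w).re + 2 := by
  have h1 := norm_c_sub_c_le_two_of_dualGraph_adj hiso h.symm
  have h2 := Complex.abs_re_le_norm (emb.c g - emb.c f)
  rw [Complex.sub_re] at h2
  simp only [Complex.sub_re]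
  linarith [(abs_le.1 (h2.trans h1)).2]

/-- The imaginary parts of the centres of dual-adjacent faces differ by at most `2`. -/
theorem dual_im_le_im_add_two_of_adj {W F : Type*} {G : SimpleGraph W}
    {emb : RhombicEmbedding G F} (hiso : emb.IsIsoradial)
    (w : ℂ) (f g : F) (h : emb.dualGraph.Adj f g) : (emb.c g - w).im ≤ (emb.c f - w).im + 2 := by
  have h1 := norm_c_sub_c_le_two_of_dualGraph_adj hiso h.symm
  have h2 := Complex.abs_im_le_norm (emb.c g - emb.c f)
  rw [Complex.sub_im] at h2
  simp only [Complex.sub_im]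
  linarith [(abs_le.1 (h2.trans h1)).2]

end Summit.CriticalPhenomena.CardyFormulaZ2.Theorems.TriSweep

/-!
# Route CardyBondTriangular — item `BondTriangularBoxCrossing`: transport of connection events

Generic bookkeeping for the comparison between the canonical measure of the hexagonal lattice
(the isoradial dual of `𝕋`) and critical bond percolation on `𝕋` (Grimmett–Manolescu 2014,
§2.2 and end of §3: "both `P_G` and `P_{G*}` have the box-crossing property"; here `G* = ℍ` is
obtained from `𝕋` by one star–triangle transformation at every up-triangle, Grimmett 1999 §11.9):

* `real_openCrossing_le_real_conn_trunc` — an open crossing inside `U` under the weights `p` is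
  at most as likely as a connection under the weights restricted to the pairs inside `U`
  (the converse inequality of `real_conn_trunc_le_openCrossing`);
* `real_conn_comp_map_le` — pulling weights on the pairs of `V'` back along an injection
  `ι : V → V'` does not increase the probability of a connection (`prodBernoulli_map_preimage`;
  an open path of the pulled-back configuration is mapped by `ι` onto an open path);
* `openCrossing_inter_eq` — the start and end sets of a crossing inside `U` may be cut down to `U`.
-/

noncomputable section

namespace Summit.CriticalPhenomena.CardyFormulaZ2.Theorems.TriSweep

open MeasureTheory Literature.Probability.Percolation Literature.Probability.LatticeModels

variable {V : Type*}

/-- The start and end sets of a crossing inside `U` may be intersected with `U`. -/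
theorem openCrossing_inter_eq (U A B : Set V) :
    (openCrossing U A B : Set (BondConfig V)) = openCrossing U (A ∩ U) (B ∩ U) := by
  ext ω
  constructor
  · rintro ⟨x, hx, y, hy, h⟩
    exact ⟨x, ⟨hx, h.1⟩, y, ⟨hy, h.2.1⟩, h⟩
  · rintro ⟨x, hx, y, hy, h⟩
    exact ⟨x, hx.1, y, hy.1, h⟩

/-- An open path inside `U` is an open path of the configuration cut down to the pairs inside
`U`. -/
theorem reachable_inter_of_mem_openConnIn {U : Set V} {ω : BondConfig V} {a b : V}
    (h : ω ∈ openConnIn U a b) : (openGraph (pairsIn U ∩ ω)).Reachable a b := by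
  obtain ⟨ha, hb, hr⟩ := h
  let φ : (openGraph ω).induce U →g openGraph (pairsIn U ∩ ω) :=
    { toFun := Subtype.val
      map_rel' := fun {x y} hxy => by
        have hxy' : (openGraph ω).Adj x.1 y.1 := hxy
        rw [openGraph_adj] at hxy' ⊢
        exact ⟨⟨mk_mem_pairsIn.2 ⟨x.2, y.2⟩, hxy'.1⟩, hxy'.2⟩ }
  exact hr.map φ

/-- **An open crossing inside `U` is at most as likely as a connection under the restricted
weights** (`truncW U p`: all pairs not inside `U` switched off). Together with
`real_conn_trunc_le_openCrossing` this is an equality for `A ⊆ U`. -/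
theorem real_openCrossing_le_real_conn_trunc [Countable V] (p : Sym2 V → unitInterval)
    (U A B : Set V) :
    (prodBernoulli p).real (openCrossing U A B) ≤ (prodBernoulli (truncW U p)).real (conn A B) := by
  classical
  set F : Set (Sym2 V) := pairsIn U with hF
  have hmeas_inter : Measurable fun ω : Set (Sym2 V) => F ∩ ω :=
    measurable_set_iff.2 fun j => by
      by_cases hj : j ∈ F
      · have : (fun ω : Set (Sym2 V) => j ∈ F ∩ ω) = fun ω => j ∈ ω := by
          funext ω; exact propext ⟨fun h => h.2, fun h => ⟨hj, h⟩⟩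
        rw [this]; exact measurable_set_mem j
      · have : (fun ω : Set (Sym2 V) => j ∈ F ∩ ω) = fun _ => False := by
          funext ω; exact propext ⟨fun h => hj h.1, False.elim⟩
        rw [this]; exact measurable_const
  have hlaw : (prodBernoulli p).map (fun ω => F ∩ ω) = prodBernoulli (truncW U p) := by
    rw [BondTri.prodBernoulli_map_inter]
    rfl
  have hmono : openCrossing U A B ⊆ (fun ω => F ∩ ω) ⁻¹' conn A B := by
    rintro ω ⟨a, haA, b, hbB, hab⟩
    simp only [Set.mem_preimage, mem_conn_iff]
    exact ⟨a, haA, b, hbB, reachable_inter_of_mem_openConnIn hab⟩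
  calc (prodBernoulli p).real (openCrossing U A B)
      ≤ (prodBernoulli p).real ((fun ω => F ∩ ω) ⁻¹' conn A B) := measureReal_mono hmono
    _ = ((prodBernoulli p).map (fun ω => F ∩ ω)).real (conn A B) :=
        (map_measureReal_apply hmeas_inter (measurableSet_conn A B)).symm
    _ = (prodBernoulli (truncW U p)).real (conn A B) := by rw [hlaw]

/-- **Pulling the weights back along an injection does not increase connection probabilities.**
For an injection `ι : V → V'` and weights `q` on the pairs of `V'`, the probability under the
pulled-back weights `q ∘ Sym2.map ι` that `A` is joined to `B` is at most the probability under
`q` that `ι '' A` is joined to `ι '' B` (the configuration `(Sym2.map ι)⁻¹' ω` has the law of the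
pulled-back weights, `prodBernoulli_map_preimage`, and its open paths are mapped by `ι` onto open
paths of `ω`). -/
theorem real_conn_comp_map_le [Countable V] {V' : Type*} [Countable V'] {ι : V → V'}
    (hι : Function.Injective ι) (q : Sym2 V' → unitInterval) (A B : Set V) :
    (prodBernoulli (q ∘ Sym2.map ι)).real (conn A B) ≤
      (prodBernoulli q).real (conn (ι '' A) (ι '' B)) := by
  have hinj : Function.Injective (Sym2.map ι) := Sym2.map.injective hι
  have hlaw := prodBernoulli_map_preimage q hinj
  have hmeas : Measurable fun S : Set (Sym2 V') => Sym2.map ι ⁻¹' S :=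
    measurable_set_iff.2 fun a => measurable_set_mem (Sym2.map ι a)
  have hmono : (fun S : Set (Sym2 V') => Sym2.map ι ⁻¹' S) ⁻¹' conn A B ⊆ conn (ι '' A) (ι '' B) := by
    intro ω hω
    simp only [Set.mem_preimage, mem_conn_iff] at hω ⊢
    obtain ⟨a, ha, b, hb, hab⟩ := hω
    let φ : openGraph (Sym2.map ι ⁻¹' ω) →g openGraph ω :=
      { toFun := ι
        map_rel' := fun {x y} hxy => by
          rw [openGraph_adj] at hxy ⊢
          exact ⟨by simpa [Sym2.map_mk] using hxy.1, hι.ne hxy.2⟩ }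
    exact ⟨ι a, Set.mem_image_of_mem ι ha, ι b, Set.mem_image_of_mem ι hb, hab.map φ⟩
  calc (prodBernoulli (q ∘ Sym2.map ι)).real (conn A B)
      = ((prodBernoulli q).map fun S : Set (Sym2 V') => Sym2.map ι ⁻¹' S).real (conn A B) := by
        rw [hlaw]; rfl
    _ = (prodBernoulli q).real ((fun S : Set (Sym2 V') => Sym2.map ι ⁻¹' S) ⁻¹' conn A B) :=
        map_measureReal_apply hmeas (measurableSet_conn A B)
    _ ≤ (prodBernoulli q).real (conn (ι '' A) (ι '' B)) := measureReal_mono hmono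

end Summit.CriticalPhenomena.CardyFormulaZ2.Theorems.TriSweep

end
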